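import Literature.AlgebraicGeometry.Frobenioids.PadicFrobenioidBaseGaloisSystemPush
import HarnessLib

/-!
# `Ψ^Base = θ_*`, II: the natural isomorphism `φ_* ≅ E` and the packaged base step of [FrdII] Thm. 2.4

Mochizuki, *The geometry of Frobenioids II*, Kyushu J. Math. **62** (2008) 401–460, §2, Theorem 2.4, p. 19
[cite: MochizukiFrdII2008, Thm 2.4 (i) p.19]: "`Ψ` … necessarily induces a 1-compatible equivalence of categories
`Ψ_Base : D₁ ⥲ D₂`, hence an outer isomorphism of topological groups `Π₁ ⥲ Π₂` [cf. [Mzk2], Proposition 3.2] that lies over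
an outer isomorphism of topological groups `G₁ ⥲ G₂`", `Dᵢ = 𝓑^temp(Πᵢ, Πᵢ°)⁰` (small model `RelCosetCat Πᵢ°`).

Sequel (seat abc-iut-L1-t7) to `PadicFrobenioidBaseGaloisSystemPush.lean` (§0–§3: the straightened abstract `φ : Π₁ ≃* Π₂` of
abc-iut-w5-d194 is a homeomorphism, `toContinuousMulEquiv`; base points `y_X ∈ E(Π₁/U)` with stabiliser exactly `φ(U)`,
`smul_basePt_eq_iff`).  Here:

* §4 `pushHomApp X : φ_*(Π₁/U) = Π₂/φ(U) → E(Π₁/U)`, `y·φ(U) ↦ y·y_X`, bijective hence an isomorphism (`pushIsoApp`), NATURAL in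
  `X = Π₁/U` (`pushHomApp_naturality`, read off `E(f)(y_X) = φ(a)·y_{X'}` for `pt f = a·U'`), whence
  **`pushIso : RelCosetCat.incl Π₁° ⋙ CosetCat.push φ ≅ E.functor ⋙ RelCosetCat.incl Π₂°`** — "`Ψ_Base = φ_*` 1-compatibly";
  and `exists_conj_apply_mem` — `φ(Π₁°)` is conjugate into `Π₂°`;
* §5 the packaged statements: `exists_continuousMulEquiv_pushIso_of_relCosetCat_equivalence` (every equivalence
  `RelCosetCat Π₁° ≌ RelCosetCat Π₂°` of tempered, Galois-countable groups is naturally `φ_*` for some `φ : Π₁ ≃ₜ* Π₂`) and the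
  consumer form `exists_hom_pushIso_of_relCosetCat_equivalence` (a continuous open bijective `θ : Π₁ →* Π₂` — exactly the
  structural input {`θ`, `hθc`, `hθo`, `hθs`} of `PadicKummerThm24iFrobenioidRelTheta.thm24i_ofFunctorRel_ofTheta`, the
  natural isomorphism supplying its {`e`, `compat`} at every object).

Classical Galois-category bookkeeping (SGA 1 V §4; [SemiAnbd] Prop. 3.2 / Rmk. 3.2.1 for equivalences of connected parts) over
landed files; nothing here bears on [IUTchIII] Cor. 3.12; no statement of either paper is strengthened.
-/

noncomputable section

namespace Literature.AlgebraicGeometry.Frobenioids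

open CategoryTheory Opposite Topology Filter
open Literature.AnabelianGeometry.SemiGraphs

universe u

namespace BaseGaloisSystem

variable {G : Type u} [Group G] [TopologicalSpace G]

section Straightened

variable (hG : IsTempered G) (H : OpenSubgroup G)
  {G₂ : Type u} [Group G₂] [TopologicalSpace G₂] (hG₂ : IsTempered G₂) (H₂ : OpenSubgroup G₂)
  (E : RelCosetCat H ≌ RelCosetCat H₂)
  (N : ℕ → OpenNormalSubgroup G) (hN : Antitone N) (hNH : ∀ k, (N k).toOpenSubgroup ≤ H)
  (hNb : ∀ U ∈ 𝓝 (1 : G), ∃ k, (N k : Set G) ⊆ U)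
  (N₂ : ℕ → OpenNormalSubgroup G₂) (hN₂ : Antitone N₂) (hNH₂ : ∀ k, (N₂ k).toOpenSubgroup ≤ H₂)
  (hN₂b : ∀ U ∈ 𝓝 (1 : G₂), ∃ k, (N₂ k : Set G₂) ⊆ U)
  (ι : relCosetSystem H N hN hNH ⋙ E.functor.op ≅ relCosetSystem H₂ N₂ hN₂ hNH₂) (φ : G ≃* G₂)
  (hφ : ∀ g : G, toAutRelCosetMulEquiv H₂ N₂ hN₂ hNH₂ hG₂ hN₂b (φ g) =
    ι.conjAut ((Equivalence.congrRight (E := ℕ) E.op).functor.mapIso (toAutRelCosetMulEquiv H N hN hNH hG hNb g)))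

/-! ### §4 `φ_*(Π₁/U) = Π₂/φ(U) ⥲ E(Π₁/U)`, naturally in `Π₁/U` -/

variable (hφo : IsOpenMap φ.toMonoidHom)

include hφ in
/-- The base point is fixed by `φ(U)`. [cite: MochizukiFrdII2008, Thm 2.4 (i) p.19] -/
theorem basePt_fixed (X : RelCosetCat H) :
    ∀ u ∈ ((CosetCat.push φ.toMonoidHom hφo).obj X.obj).sg,
      u • basePt H H₂ E N hN hNH hNb N₂ hN₂ hNH₂ ι X = basePt H H₂ E N hN hNH hNb N₂ hN₂ hNH₂ ι X := by
  intro u hu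
  obtain ⟨π, hπ, rfl⟩ := (CosetCat.mem_mapOpen φ.toMonoidHom hφo).mp hu
  exact (smul_basePt_eq_iff hG H hG₂ H₂ E N hN hNH hNb N₂ hN₂ hNH₂ hN₂b ι φ hφ X π).mpr hπ

/-- **The comparison morphism `Π₂/φ(U) → E(Π₁/U)`**, `y·φ(U) ↦ y · y_X`. [cite: MochizukiFrdII2008, Thm 2.4 (i) p.19] -/
def pushHomApp (X : RelCosetCat H) : (CosetCat.push φ.toMonoidHom hφo).obj X.obj ⟶ (E.functor.obj X).obj :=
  CosetCat.homMk (basePt H H₂ E N hN hNH hNb N₂ hN₂ hNH₂ ι X)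
    (basePt_fixed hG H hG₂ H₂ E N hN hNH hNb N₂ hN₂ hNH₂ hN₂b ι φ hφ hφo X)

/-- Its point is the base point. [cite: MochizukiFrdII2008, Thm 2.4 (i) p.19] -/
@[simp] theorem pt_pushHomApp (X : RelCosetCat H) :
    CosetCat.pt (pushHomApp hG H hG₂ H₂ E N hN hNH hNb N₂ hN₂ hNH₂ hN₂b ι φ hφ hφo X) =
      basePt H H₂ E N hN hNH hNb N₂ hN₂ hNH₂ ι X :=
  CosetCat.pt_homMk _ _

/-- `Π₂/φ(U) → E(Π₁/U)` is bijective (injective because the stabiliser of `y_X` is `φ(U)` and no more; every morphism of the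
coset category is surjective). [cite: MochizukiFrdII2008, Thm 2.4 (i) p.19] -/
theorem pushHomApp_bijective (X : RelCosetCat H) :
    Function.Bijective (CosetCat.Hom.toFun (pushHomApp hG H hG₂ H₂ E N hN hNH hNb N₂ hN₂ hNH₂ hN₂b ι φ hφ hφo X)) := by
  refine ⟨fun x x' hxx' => ?_, CosetCat.toFun_surjective _⟩
  obtain ⟨a, rfl⟩ := QuotientGroup.mk_surjective x
  obtain ⟨a', rfl⟩ := QuotientGroup.mk_surjective x'
  rw [pushHomApp, CosetCat.homMk_toFun_coe, CosetCat.homMk_toFun_coe] at hxx'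
  have h1 : (a⁻¹ * a') • basePt H H₂ E N hN hNH hNb N₂ hN₂ hNH₂ ι X = basePt H H₂ E N hN hNH hNb N₂ hN₂ hNH₂ ι X := by
    rw [mul_smul, ← hxx', ← mul_smul, inv_mul_cancel, one_smul]
  have h2 := (smul_basePt_eq_iff' hG H hG₂ H₂ E N hN hNH hNb N₂ hN₂ hNH₂ hN₂b ι φ hφ X (a⁻¹ * a')).mp h1
  refine QuotientGroup.eq.mpr ((CosetCat.mem_mapOpen φ.toMonoidHom hφo).mpr ⟨φ.symm (a⁻¹ * a'), h2, ?_⟩)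
  exact φ.apply_symm_apply _

/-- `Π₂/φ(U) → E(Π₁/U)` is an isomorphism. [cite: MochizukiFrdII2008, Thm 2.4 (i) p.19] -/
theorem isIso_pushHomApp (X : RelCosetCat H) :
    IsIso (pushHomApp hG H hG₂ H₂ E N hN hNH hNb N₂ hN₂ hNH₂ hN₂b ι φ hφ hφo X) :=
  CosetCat.isIso_of_bijective _ (pushHomApp_bijective hG H hG₂ H₂ E N hN hNH hNb N₂ hN₂ hNH₂ hN₂b ι φ hφ hφo X)

/-- **`φ_*(Π₁/U) ≅ E(Π₁/U)`** in `𝓑^temp(Π₂)⁰`. [cite: MochizukiFrdII2008, Thm 2.4 (i) p.19] -/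
def pushIsoApp (X : RelCosetCat H) : (CosetCat.push φ.toMonoidHom hφo).obj X.obj ≅ (E.functor.obj X).obj :=
  haveI := isIso_pushHomApp hG H hG₂ H₂ E N hN hNH hNb N₂ hN₂ hNH₂ hN₂b ι φ hφ hφo X
  asIso (pushHomApp hG H hG₂ H₂ E N hN hNH hNb N₂ hN₂ hNH₂ hN₂b ι φ hφ hφo X)

/-- `(pushIsoApp X).hom = pushHomApp X`. [cite: MochizukiFrdII2008, Thm 2.4 (i) p.19] -/
@[simp] theorem pushIsoApp_hom (X : RelCosetCat H) :
    (pushIsoApp hG H hG₂ H₂ E N hN hNH hNb N₂ hN₂ hNH₂ hN₂b ι φ hφ hφo X).hom =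
      pushHomApp hG H hG₂ H₂ E N hN hNH hNb N₂ hN₂ hNH₂ hN₂b ι φ hφ hφo X := rfl

include hφ in
/-- **Action of `E` on morphisms, read on base points**: for `f : Π₁/U → Π₁/U'` with `pt f = a·U'`,
`E(f)(y_X) = φ a · y_{X'}`. [cite: MochizukiFrdII2008, Thm 2.4 (i) p.19] -/
theorem map_toFun_basePt {X X' : RelCosetCat H} (f : X ⟶ X') (a : G) (ha : CosetCat.pt f.hom = ((a : G) : X'.obj.carrier)) :
    CosetCat.Hom.toFun (E.functor.map f).hom (basePt H H₂ E N hN hNH hNb N₂ hN₂ hNH₂ ι X) =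
      φ a • basePt H H₂ E N hN hNH hNb N₂ hN₂ hNH₂ ι X' := by
  -- a common level for `X` and `X'`
  set k := max (lvl H N hNb X) (lvl H N hNb X') with hkdef
  have hk : (N k).toOpenSubgroup ≤ X.obj.sg := fun x hx => lvl_le H N hNb X (hN (le_max_left _ _) hx)
  have hk' : (N k).toOpenSubgroup ≤ X'.obj.sg := fun x hx => lvl_le H N hNb X' (hN (le_max_right _ _) hx)
  rw [basePt_eq H H₂ E N hN hNH hNb N₂ hN₂ hNH₂ ι X k hk, basePt_eq H H₂ E N hN hNH hNb N₂ hN₂ hNH₂ ι X' k hk',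
    smul_pt_cmp hG H hG₂ H₂ E N hN hNH hNb N₂ hN₂ hNH₂ hN₂b ι φ hφ X' k hk' a, ← CosetCat.pt_comp,
    ← ObjectProperty.FullSubcategory.comp_hom, cmp, Category.assoc, ← Functor.map_comp]
  have hfac : (ObjectProperty.homMk (cprojTo (N k) X.obj hk) : rQ H (N k) (hNH k) ⟶ X) ≫ f =
      ObjectProperty.homMk (crightMul (N k) a ≫ cprojTo (N k) X'.obj hk') :=
    ObjectProperty.hom_ext _ (cprojTo_comp_eq (N k) hk hk' f.hom a ha)
  rw [hfac]

include hφ in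
/-- **Naturality** of `X ↦ (Π₂/φ(U) ⥲ E(Π₁/U))` in `X = Π₁/U ∈ 𝓑^temp(Π₁, Π₁°)⁰`. [cite: MochizukiFrdII2008, Thm 2.4 (i) p.19] -/
theorem pushHomApp_naturality {X X' : RelCosetCat H} (f : X ⟶ X') :
    (CosetCat.push φ.toMonoidHom hφo).map f.hom ≫ pushHomApp hG H hG₂ H₂ E N hN hNH hNb N₂ hN₂ hNH₂ hN₂b ι φ hφ hφo X' =
      pushHomApp hG H hG₂ H₂ E N hN hNH hNb N₂ hN₂ hNH₂ hN₂b ι φ hφ hφo X ≫ (E.functor.map f).hom := by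
  obtain ⟨a, ha⟩ := QuotientGroup.mk_surjective (CosetCat.pt f.hom)
  refine CosetCat.hom_ext ?_
  rw [CosetCat.pt_comp, CosetCat.pt_comp, CosetCat.pt_push_map, ← ha, CosetCat.pushQuot_coe, pushHomApp,
    CosetCat.homMk_toFun_coe, pt_pushHomApp, map_toFun_basePt hG H hG₂ H₂ E N hN hNH hNb N₂ hN₂ hNH₂ hN₂b ι φ hφ f a ha.symm]
  rfl

/-- **`Ψ_Base = φ_*` 1-compatibly: the NATURAL isomorphism `RelCosetCat.incl Π₁° ⋙ φ_* ≅ E ⋙ RelCosetCat.incl Π₂°`** of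
functors `𝓑^temp(Π₁, Π₁°)⁰ ⥤ 𝓑^temp(Π₂)⁰` ("`Ψ_Base : D₁ ⥲ D₂`, hence an outer isomorphism of topological groups `Π₁ ⥲ Π₂`").
CONSTRUCTED. [cite: MochizukiFrdII2008, Thm 2.4 (i) p.19] -/
def pushIso : RelCosetCat.incl H ⋙ CosetCat.push φ.toMonoidHom hφo ≅ E.functor ⋙ RelCosetCat.incl H₂ :=
  NatIso.ofComponents (fun X => pushIsoApp hG H hG₂ H₂ E N hN hNH hNb N₂ hN₂ hNH₂ hN₂b ι φ hφ hφo X)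
    (fun f => pushHomApp_naturality hG H hG₂ H₂ E N hN hNH hNb N₂ hN₂ hNH₂ hN₂b ι φ hφ hφo f)

/-- Components of `pushIso`. [cite: MochizukiFrdII2008, Thm 2.4 (i) p.19] -/
@[simp] theorem pushIso_hom_app (X : RelCosetCat H) :
    (pushIso hG H hG₂ H₂ E N hN hNH hNb N₂ hN₂ hNH₂ hN₂b ι φ hφ hφo).hom.app X =
      pushHomApp hG H hG₂ H₂ E N hN hNH hNb N₂ hN₂ hNH₂ hN₂b ι φ hφ hφo X := rfl

include hφ hφo in
/-- **`φ(Π₁°)` is conjugate into `Π₂°`**: `E(Π₁/Π₁°) ≅ Π₂/φ(Π₁°)` lies in `𝓑^temp(Π₂, Π₂°)⁰`. [cite: MochizukiFrdII2008, Ex 1.3 (i) p.11] -/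
theorem exists_conj_apply_mem : ∃ y : G₂, ∀ u ∈ H, y⁻¹ * φ u * y ∈ H₂ := by
  have hadm : CosetCat.admitsHomTo H₂ ((CosetCat.push φ.toMonoidHom hφo).obj (RelCosetCat.coset H).obj) :=
    CosetCat.admitsHomTo_of_hom H₂ (pushHomApp hG H hG₂ H₂ E N hN hNH hNb N₂ hN₂ hNH₂ hN₂b ι φ hφ hφo (RelCosetCat.coset H))
      (E.functor.obj (RelCosetCat.coset H)).property
  obtain ⟨y, hy⟩ := (CosetCat.admitsHomTo_iff H₂ _).mp hadm
  exact ⟨y, fun u hu => hy (φ u) ((CosetCat.mem_mapOpen φ.toMonoidHom hφo).mpr ⟨u, hu, rfl⟩)⟩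

end Straightened

/-! ### §5 Packaged statements -/

section Packaged

variable [IsTopologicalGroup G] [SecondCountableTopology G] (hG : IsTempered G) (H : OpenSubgroup G)
  {G₂ : Type u} [Group G₂] [TopologicalSpace G₂] [IsTopologicalGroup G₂] (hG₂ : IsTempered G₂) (H₂ : OpenSubgroup G₂)
  (E : RelCosetCat H ≌ RelCosetCat H₂)

include hG hG₂ in
/-- **[FrdII] Thm. 2.4, base step / [SemiAnbd] Prop. 3.2 for equivalences of connected parts:** every equivalence
`E : 𝓑^temp(Π₁, Π₁°)⁰ ⥲ 𝓑^temp(Π₂, Π₂°)⁰` (small models; `Πᵢ` tempered, `Π₁` Galois-countable) is, naturally, push-forward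
along an isomorphism of TOPOLOGICAL groups `φ : Π₁ ⥲ Π₂`: `RelCosetCat.incl Π₁° ⋙ φ_* ≅ E ⋙ RelCosetCat.incl Π₂°`; moreover
`φ(Π₁°)` is conjugate into `Π₂°`. [cite: MochizukiFrdII2008, Thm 2.4 (i) p.19] -/
theorem exists_continuousMulEquiv_pushIso_of_relCosetCat_equivalence :
    ∃ (φ : G ≃ₜ* G₂) (hφo : IsOpenMap φ.toMulEquiv.toMonoidHom),
      Nonempty (RelCosetCat.incl H ⋙ CosetCat.push φ.toMulEquiv.toMonoidHom hφo ≅ E.functor ⋙ RelCosetCat.incl H₂) ∧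
        ∃ y : G₂, ∀ u ∈ H, y⁻¹ * φ u * y ∈ H₂ := by
  obtain ⟨N, hN, hNb, hNH⟩ := exists_antitone_cofinal_seq_le H hG
  obtain ⟨N₂, hN₂, hNH₂, hN₂b, ι, φ, hφ⟩ := exists_mulEquiv_compatible_of_relCosetCat_equivalence H N hN hNH hG hG₂ H₂ E hNb
  have hφo := isOpenMap_mulEquiv hG H hG₂ H₂ E N hN hNH hNb N₂ hN₂ hNH₂ hN₂b ι φ hφ
  exact ⟨toContinuousMulEquiv hG H hG₂ H₂ E N hN hNH hNb N₂ hN₂ hNH₂ hN₂b ι φ hφ, hφo,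
    ⟨pushIso hG H hG₂ H₂ E N hN hNH hNb N₂ hN₂ hNH₂ hN₂b ι φ hφ hφo⟩,
    exists_conj_apply_mem hG H hG₂ H₂ E N hN hNH hNb N₂ hN₂ hNH₂ hN₂b ι φ hφ hφo⟩

include hG hG₂ in
/-- **Consumer form** (the structural input `θ` of `PadicKummerThm24iFrobenioidRelTheta.thm24i_ofFunctorRel_ofTheta`): a
continuous OPEN BIJECTIVE homomorphism `θ : Π₁ → Π₂` with `RelCosetCat.incl Π₁° ⋙ θ_* ≅ E ⋙ RelCosetCat.incl Π₂°`.
[cite: MochizukiFrdII2008, Thm 2.4 (i) p.19] -/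
theorem exists_hom_pushIso_of_relCosetCat_equivalence :
    ∃ (θ : G →* G₂) (_ : Continuous θ) (hθo : IsOpenMap θ) (_ : Function.Bijective θ),
      Nonempty (RelCosetCat.incl H ⋙ CosetCat.push θ hθo ≅ E.functor ⋙ RelCosetCat.incl H₂) ∧
        ∃ y : G₂, ∀ u ∈ H, y⁻¹ * θ u * y ∈ H₂ := by
  obtain ⟨φ, hφo, ⟨e⟩, hH⟩ := exists_continuousMulEquiv_pushIso_of_relCosetCat_equivalence hG H hG₂ H₂ E
  exact ⟨φ.toMulEquiv.toMonoidHom, φ.continuous_toFun, hφo, φ.bijective, ⟨e⟩, hH⟩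

end Packaged

end BaseGaloisSystem

end Literature.AlgebraicGeometry.Frobenioids

end
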